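import Summits.QuantumFields.YangMills.Theorems.IR.TypFormatCoarsen
import Summits.QuantumFields.YangMills.Theorems.IR.TypFormatRobustSharp
import HarnessLib

/-!
# Crux `IR` (stmt-QuantumFields-19354), lane B: the typical onsets AT WINDOW ONE — `OnsetMixingTypicalUKPc` and I♯_SC (`OnsetSharpUKPcSC`) are
# equivalent to their window-`1` forms (mesh coarsening by the factor `j(2n+1)`, calibration `T ↦ j(2n+1)·T`)

Helper module for item `stmt-QuantumFields-19354` (`--supports`; it closes nothing).  By-name corollaries of the mesh coarsening
`TypCoarsen.typShellCondUKPc_coarsen` (`Theorems/IR/TypFormatCoarsen.lean`): a typical-onset family at grade `(n, ε)` (`ε·shellCount n < 1`) with meshes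
`b(β, δ)` yields, for every large `j`, a family at WINDOW `1` with meshes `j(2n+1)·b(β, δ₀(δ))` and any prescribed admissibility target — the coarse class is
«every fine sub-cell typical», the rarity budget is absorbed by the onset statement's `∀ δ > 0`.

* `exists_coarse_exponent_lt` — `(2j(2n+1)+1)⁴·θ^j < τ` for large `j` (geometric beats quartic).
* ★ `typOnsetFamily_coarsen` — one `j ≥ 1`, side condition `P β b` carried to the fine mesh `b` (the coarse mesh is `j(2n+1)·b`).
* ★ `typOnsetFamily_window_one` — grade freedom AT WINDOW ONE: for every `τ > 0` a family at grade `(1, ε')`, `ε'·shellCount 1 < τ`.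
* ★★ `onsetMixingTypicalUKPc_iff_window_one`, ★★ `SharpOnset.onsetSharpUKPcSC_iff_window_one` — the registered statements are equivalent to their `n = 1` forms.

HONEST FRAMING: format-level corollaries about OPEN statements of a CONDITIONAL chain; nothing here proves them; not a gap, not Clay.
No `sorry`; axioms ⊆ {propext, Classical.choice, Quot.sound}.
-/

set_option autoImplicit false

noncomputable section

open MeasureTheory Filter Topology
open Literature.MathematicalPhysics
open Literature.MathematicalPhysics.QuantumFieldTheory Literature.MathematicalPhysics.QuantumLattice
open Summit.QuantumFields.YangMills.Cruxes.OSLegsFromFemtoAndGap.DlrCollarTransfer (LowerBounds)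
open Summit.QuantumFields.YangMills.Cruxes.IR.OnsetFormats (shellCount)
open Summit.QuantumFields.YangMills.Cruxes.IR.OnsetFormatsUc (TypShellCondUKPc OnsetMixingTypicalUKPc)
open Summit.QuantumFields.YangMills.Cruxes.IR.OnsetFormatsUc.TypBootstrap (typShellCondUKPc_mono)
open Summit.QuantumFields.YangMills.Cruxes.IR.OnsetFormatsUc.TypCoarsen (typShellCondUKPc_coarsen)

namespace Summit.QuantumFields.YangMills.Cruxes.IR.OnsetFormatsUc.TypCoarsen

/-- **Geometric beats quartic (coarsening form)**: for `0 ≤ θ < 1`, `τ > 0` and any `n` there is `j ≥ 1` with `(2j(2n+1)+1)⁴·θ^j < τ`. -/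
theorem exists_coarse_exponent_lt {θ τ : ℝ} (hθ0 : 0 ≤ θ) (hθ1 : θ < 1) (hτ : 0 < τ) (n : ℕ) :
    ∃ j : ℕ, 1 ≤ j ∧ (((2 * (j * (2 * n + 1)) + 1) ^ 4 : ℕ) : ℝ) * θ ^ j < τ := by
  set C : ℝ := (3 * (2 * (n : ℝ) + 1)) ^ 4 with hC
  have hCq : ∀ j : ℕ, 1 ≤ j → (((2 * (j * (2 * n + 1)) + 1) ^ 4 : ℕ) : ℝ) * θ ^ j ≤ C * ((j : ℝ) ^ 4 * θ ^ j) := by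
    intro j hj
    have hj' : (1 : ℝ) ≤ j := by exact_mod_cast hj
    have hle : (((2 * (j * (2 * n + 1)) + 1) ^ 4 : ℕ) : ℝ) ≤ C * (j : ℝ) ^ 4 := by
      have h7 : (2 * ((j : ℝ) * (2 * (n : ℝ) + 1)) + 1) ≤ 3 * (2 * (n : ℝ) + 1) * j := by nlinarith
      have h0 : (0 : ℝ) ≤ 2 * ((j : ℝ) * (2 * (n : ℝ) + 1)) + 1 := by positivity
      have h8 := pow_le_pow_left₀ h0 h7 4
      have e : C * (j : ℝ) ^ 4 = (3 * (2 * (n : ℝ) + 1) * j) ^ 4 := by rw [hC]; ring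
      rw [e]
      push_cast
      exact h8
    calc (((2 * (j * (2 * n + 1)) + 1) ^ 4 : ℕ) : ℝ) * θ ^ j ≤ C * (j : ℝ) ^ 4 * θ ^ j :=
          mul_le_mul_of_nonneg_right hle (pow_nonneg hθ0 j)
      _ = C * ((j : ℝ) ^ 4 * θ ^ j) := by ring
  have hlim : Tendsto (fun j : ℕ => C * ((j : ℝ) ^ 4 * θ ^ j)) atTop (𝓝 0) := by
    have h := tendsto_pow_const_mul_const_pow_of_abs_lt_one 4 (abs_lt.2 ⟨by linarith, hθ1⟩)
    simpa using h.const_mul C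
  obtain ⟨J, hJ⟩ := Metric.tendsto_atTop.1 hlim τ hτ
  refine ⟨max J 1, le_max_right _ _, ?_⟩
  have h1 := hJ (max J 1) (le_max_left _ _)
  rw [Real.dist_eq, sub_zero] at h1
  exact (hCq _ (le_max_right _ _)).trans_lt (lt_of_abs_lt h1)

section Family

variable {G : Type} [Group G] [TopologicalSpace G] [IsTopologicalGroup G] [CompactSpace G]
  [MeasurableSpace G] [BorelSpace G] [SecondCountableTopology G] [T2Space G]
  {N : ℕ} {ρ : G →* Matrix (Fin N) (Fin N) ℂ}

/-- **Coarsening of a typical-onset family by the factor `K = j(2n+1)`** (`j ≥ 1`): a family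
`∀ δ > 0, ∃ t β₂, ∀ β ≥ β₂, ∃ b ≥ 1, P t β b ∧ TypShellCondUKPc ρ β b n ε δ` (`0 ≤ ε`, `ε·shellCount n ≤ 1`; the side condition `P t β b` carries a
budget-level parameter `t`, e.g. a calibration constant) yields, for every `ε' > (2K+1)⁴·(ε·shellCount n)^j`, the window-`1` family with meshes `K·b`:
`∀ δ > 0, ∃ t β₂, ∀ β ≥ β₂, ∃ b ≥ 1, P t β b ∧ TypShellCondUKPc ρ β (K·b) 1 ε' δ` (`typShellCondUKPc_coarsen` at the budget `δ₀ = min (δ/P⁴) ((ε' − P⁴θ^j)/(P⁴L))`). -/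
theorem typOnsetFamily_coarsen (hρ : Continuous ρ) {α : Type*} {P : α → ℝ → ℕ → Prop} {n : ℕ} {ε : ℝ} (hε : 0 ≤ ε)
    (hεM : ε * shellCount n ≤ 1)
    (h : ∀ δ : ℝ, 0 < δ → ∃ (t : α) (β₂ : ℝ), ∀ β : ℝ, β₂ ≤ β → ∃ b : ℕ, 1 ≤ b ∧ P t β b ∧ TypShellCondUKPc ρ β b n ε δ)
    {j : ℕ} (hj : 1 ≤ j) {ε' : ℝ} (hε' : (((2 * (j * (2 * n + 1)) + 1) ^ 4 : ℕ) : ℝ) * (ε * shellCount n) ^ j < ε') :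
    ∀ δ : ℝ, 0 < δ → ∃ (t : α) (β₂ : ℝ), ∀ β : ℝ, β₂ ≤ β →
      ∃ b : ℕ, 1 ≤ b ∧ P t β b ∧ TypShellCondUKPc ρ β (j * (2 * n + 1) * b) 1 ε' δ := by
  intro δ hδ
  set K : ℕ := j * (2 * n + 1) with hK
  have hK1 : 1 ≤ K := le_trans hj (Nat.le_mul_of_pos_right j (by omega))
  set P4 : ℝ := (((2 * K + 1) ^ 4 : ℕ) : ℝ) with hP4
  have hP4pos : 0 < P4 := by rw [hP4]; positivity
  set θ : ℝ := ε * shellCount n with hθ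
  set L : ℝ := (j : ℝ) * ((2 + 3 * ε) * shellCount n) + 1 with hL
  have hSn : 0 ≤ shellCount n := by
    unfold Summit.QuantumFields.YangMills.Cruxes.IR.OnsetFormats.shellCount; positivity
  have hL0 : 0 < L := by
    have : 0 ≤ (j : ℝ) * ((2 + 3 * ε) * shellCount n) := mul_nonneg (Nat.cast_nonneg _) (mul_nonneg (by linarith) hSn)
    linarith
  have hgap : 0 < ε' - P4 * θ ^ j := by
    have e : (2 * K + 1) = 2 * (j * (2 * n + 1)) + 1 := by rw [hK]
    rw [hP4, hθ, e]; linarith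
  -- the budget: `P4·(θ^j + L·δ₀) ≤ ε'` and `P4·δ₀ ≤ δ`
  set δ₀ : ℝ := min (δ / P4) ((ε' - P4 * θ ^ j) / (P4 * L)) with hδ₀
  have hδ₀pos : 0 < δ₀ := lt_min (div_pos hδ hP4pos) (div_pos hgap (mul_pos hP4pos hL0))
  have hδ₀δ : P4 * δ₀ ≤ δ := by
    have h1 : δ₀ ≤ δ / P4 := min_le_left _ _
    calc P4 * δ₀ ≤ P4 * (δ / P4) := mul_le_mul_of_nonneg_left h1 hP4pos.le
      _ = δ := mul_div_cancel₀ δ hP4pos.ne'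
  have hδ₀ε : P4 * (θ ^ j + (j : ℝ) * ((2 + 3 * ε) * shellCount n * δ₀) + δ₀) ≤ ε' := by
    have h1 : δ₀ ≤ (ε' - P4 * θ ^ j) / (P4 * L) := min_le_right _ _
    have h2 : P4 * L * δ₀ ≤ ε' - P4 * θ ^ j := by
      calc P4 * L * δ₀ ≤ P4 * L * ((ε' - P4 * θ ^ j) / (P4 * L)) := mul_le_mul_of_nonneg_left h1 (mul_pos hP4pos hL0).le
        _ = ε' - P4 * θ ^ j := mul_div_cancel₀ _ (mul_pos hP4pos hL0).ne'
    have e : P4 * (θ ^ j + (j : ℝ) * ((2 + 3 * ε) * shellCount n * δ₀) + δ₀) = P4 * θ ^ j + P4 * L * δ₀ := by rw [hL]; ring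
    rw [e]
    linarith
  obtain ⟨t, β₂, hβ⟩ := h δ₀ hδ₀pos
  refine ⟨t, β₂, fun β hb => ?_⟩
  obtain ⟨b, hb1, hP, hT⟩ := hβ β hb
  refine ⟨b, hb1, hP, ?_⟩
  have hbB : b ≤ K * b := Nat.le_mul_of_pos_left b (by omega)
  have hdiv : K * b / b = K := Nat.mul_div_cancel K (by omega)
  have hjK : j * (2 * n + 1) ≤ 2 * (K * b / b) := by rw [hdiv, hK]; omega
  have hc := typShellCondUKPc_coarsen ρ hρ hb1 hbB hε hεM hδ₀pos.le j hjK hT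
  rw [hdiv] at hc
  exact typShellCondUKPc_mono ρ hδ₀ε (by positivity) hδ₀δ hc

/-- **Typical onset AT WINDOW ONE (grade freedom)**: a typical-onset family (with budget-level side data) at any grade `(n, ε)` with `ε·shellCount n < 1`
yields, for every target `τ > 0`, some `j ≥ 1` and `ε' > 0` with `ε'·shellCount 1 < τ` and the window-`1` family with meshes `j(2n+1)·b`. -/
theorem typOnsetFamily_window_one (hρ : Continuous ρ) {α : Type*} {P : α → ℝ → ℕ → Prop} {n : ℕ} {ε : ℝ} (hε : 0 ≤ ε)
    (hεM : ε * shellCount n < 1)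
    (h : ∀ δ : ℝ, 0 < δ → ∃ (t : α) (β₂ : ℝ), ∀ β : ℝ, β₂ ≤ β → ∃ b : ℕ, 1 ≤ b ∧ P t β b ∧ TypShellCondUKPc ρ β b n ε δ)
    {τ : ℝ} (hτ : 0 < τ) :
    ∃ (j : ℕ) (ε' : ℝ), 1 ≤ j ∧ 0 < ε' ∧ ε' * shellCount 1 < τ ∧
      ∀ δ : ℝ, 0 < δ → ∃ (t : α) (β₂ : ℝ), ∀ β : ℝ, β₂ ≤ β →
        ∃ b : ℕ, 1 ≤ b ∧ P t β b ∧ TypShellCondUKPc ρ β (j * (2 * n + 1) * b) 1 ε' δ := by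
  have hSn : 0 ≤ shellCount n := by
    unfold Summit.QuantumFields.YangMills.Cruxes.IR.OnsetFormats.shellCount; positivity
  have hS1 : 0 < shellCount 1 := by
    unfold Summit.QuantumFields.YangMills.Cruxes.IR.OnsetFormats.shellCount; norm_num
  have hθ0 : 0 ≤ ε * shellCount n := mul_nonneg hε hSn
  obtain ⟨j, hj1, hj⟩ := exists_coarse_exponent_lt hθ0 hεM (div_pos (half_pos hτ) hS1) n
  set A : ℝ := (((2 * (j * (2 * n + 1)) + 1) ^ 4 : ℕ) : ℝ) * (ε * shellCount n) ^ j with hA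
  have hA0 : 0 ≤ A := by rw [hA]; positivity
  set ε' : ℝ := A + τ / 2 / shellCount 1 with hε'def
  have hη : 0 < τ / 2 / shellCount 1 := div_pos (half_pos hτ) hS1
  refine ⟨j, ε', hj1, by linarith, ?_, typOnsetFamily_coarsen hρ hε hεM.le h hj1 (by linarith)⟩
  have h1 : A * shellCount 1 < τ / 2 := by
    have := (lt_div_iff₀ hS1).1 hj
    linarith
  rw [hε'def, add_mul, div_mul_cancel₀ _ hS1.ne']
  linarith

end Family

/-- **`OnsetMixingTypicalUKPc` is equivalent to its WINDOW-ONE form** (`n = 1`; `⇐` is the instance `n = 1`, `⇒` is the coarsening at target `3/4`). -/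
theorem onsetMixingTypicalUKPc_iff_window_one :
    OnsetMixingTypicalUKPc ↔
    ∀ (G : Type) [Group G] [TopologicalSpace G] [IsTopologicalGroup G] [CompactSpace G],
      IsCompactSimpleLieGroup G → letI : MeasurableSpace G := borel G; haveI : BorelSpace G := ⟨rfl⟩;
      ∀ r : LatticeRep G, ∃ ε : ℝ, 0 ≤ ε ∧ ε * shellCount 1 ≤ 3 / 4 ∧
        ∀ δ : ℝ, 0 < δ → ∃ β₂ : ℝ, ∀ β : ℝ, β₂ ≤ β → ∃ b : ℕ, 1 ≤ b ∧ TypShellCondUKPc r.ρ β b 1 ε δ := by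
  constructor
  · intro h G _ _ _ _ hG
    letI : MeasurableSpace G := borel G
    haveI : BorelSpace G := ⟨rfl⟩
    intro r
    haveI : T2Space G := T2Space.of_injective_continuous r.injective r.continuous
    haveI : SecondCountableTopology G :=
      (r.continuous.isClosedEmbedding r.injective).isEmbedding.secondCountableTopology
    obtain ⟨n, ε, _, hε, hM, hfam⟩ := h G hG r
    have hfam' : ∀ δ : ℝ, 0 < δ → ∃ (_t : Unit) (β₂ : ℝ), ∀ β : ℝ, β₂ ≤ β →
        ∃ b : ℕ, 1 ≤ b ∧ True ∧ TypShellCondUKPc r.ρ β b n ε δ := fun δ hδ => by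
      obtain ⟨β₂, hβ⟩ := hfam δ hδ
      exact ⟨(), β₂, fun β hb => by obtain ⟨b, hb1, hT⟩ := hβ β hb; exact ⟨b, hb1, trivial, hT⟩⟩
    obtain ⟨j, ε', hj1, hε', hlt, hfam''⟩ :=
      typOnsetFamily_window_one (P := fun (_ : Unit) _ _ => True) r.continuous hε (by linarith) hfam' (by norm_num : (0 : ℝ) < 3 / 4)
    refine ⟨ε', hε'.le, hlt.le, fun δ hδ => ?_⟩
    obtain ⟨-, β₂, hβ⟩ := hfam'' δ hδ
    refine ⟨β₂, fun β hb => ?_⟩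
    obtain ⟨b, hb1, -, hT⟩ := hβ β hb
    exact ⟨j * (2 * n + 1) * b, le_trans hb1 (Nat.le_mul_of_pos_left b (by positivity)), hT⟩
  · intro h G _ _ _ _ hG
    letI : MeasurableSpace G := borel G
    haveI : BorelSpace G := ⟨rfl⟩
    intro r
    obtain ⟨ε, hε, hM, hfam⟩ := h G hG r
    exact ⟨1, ε, le_rfl, hε, hM, hfam⟩

end Summit.QuantumFields.YangMills.Cruxes.IR.OnsetFormatsUc.TypCoarsen

namespace Summit.QuantumFields.YangMills.Cruxes.IR.AfPincerUc.SharpOnset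

open Summit.QuantumFields.YangMills.Cruxes.IR.AfPincerUc
open Summit.QuantumFields.YangMills.Cruxes.IR.OnsetFormatsUc.TypCoarsen (typOnsetFamily_window_one)

/-- **I♯_SC is equivalent to its WINDOW-ONE form** (`n = 1`; calibration constants `T ↦ j(2n+1)·T(δ₀)`). -/
theorem onsetSharpUKPcSC_iff_window_one :
    OnsetSharpUKPcSC ↔
    ∀ (G : Type) [Group G] [TopologicalSpace G] [IsTopologicalGroup G] [CompactSpace G],
      IsCompactSimpleLieGroup G → SimplyConnectedSpace G →
      letI : MeasurableSpace G := borel G; haveI : BorelSpace G := ⟨rfl⟩;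
      ∀ (r : LatticeRep G) (a : ℝ → ℝ), (∀ β, 0 < a β) → Tendsto a atTop (𝓝 0) → LowerBounds G r a →
        ∃ ε : ℝ, 0 ≤ ε ∧ ε * shellCount 1 ≤ 3 / 4 ∧
          ∀ δ : ℝ, 0 < δ → ∃ T β₂ : ℝ, ∀ β : ℝ, β₂ ≤ β →
            ∃ b : ℕ, 1 ≤ b ∧ a β * (b : ℝ) < T ∧ TypShellCondUKPc r.ρ β b 1 ε δ := by
  constructor
  · intro h G _ _ _ _ hG hsc
    letI : MeasurableSpace G := borel G
    haveI : BorelSpace G := ⟨rfl⟩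
    intro r a ha hat hlb
    haveI : T2Space G := T2Space.of_injective_continuous r.injective r.continuous
    haveI : SecondCountableTopology G :=
      (r.continuous.isClosedEmbedding r.injective).isEmbedding.secondCountableTopology
    obtain ⟨n, ε, _, hε, hM, hfam⟩ := h G hG hsc r a ha hat hlb
    have hfam' : ∀ δ : ℝ, 0 < δ → ∃ (T : ℝ) (β₂ : ℝ), ∀ β : ℝ, β₂ ≤ β → ∃ b : ℕ, 1 ≤ b ∧ a β * (b : ℝ) < T ∧
        OnsetFormatsUc.TypShellCondUKPc r.ρ β b n ε δ := fun δ hδ => by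
      obtain ⟨T, β₂, hβ⟩ := hfam δ hδ
      exact ⟨T, β₂, fun β hb => by
        obtain ⟨b, hb1, hcal, hT⟩ := hβ β hb
        exact ⟨b, hb1, hcal, (typShellCondUKPc_iff_mirror r.ρ β b n ε δ).mp hT⟩⟩
    obtain ⟨j, ε', hj1, hε', hlt, hfam''⟩ :=
      typOnsetFamily_window_one (P := fun (T : ℝ) β b => a β * (b : ℝ) < T) r.continuous hε (by linarith) hfam'
        (by norm_num : (0 : ℝ) < 3 / 4)
    refine ⟨ε', hε'.le, hlt.le, fun δ hδ => ?_⟩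
    obtain ⟨T, β₂, hβ⟩ := hfam'' δ hδ
    refine ⟨((j * (2 * n + 1) : ℕ) : ℝ) * T, β₂, fun β hb => ?_⟩
    obtain ⟨b, hb1, hcal, hT⟩ := hβ β hb
    refine ⟨j * (2 * n + 1) * b, le_trans hb1 (Nat.le_mul_of_pos_left b (by positivity)), ?_,
      (typShellCondUKPc_iff_mirror r.ρ β _ 1 ε' δ).mpr hT⟩
    have hK : (0 : ℝ) < ((j * (2 * n + 1) : ℕ) : ℝ) := by positivity
    have e : a β * (((j * (2 * n + 1) * b : ℕ) : ℝ)) = ((j * (2 * n + 1) : ℕ) : ℝ) * (a β * (b : ℝ)) := by push_cast; ring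
    rw [e]
    exact mul_lt_mul_of_pos_left hcal hK
  · intro h G _ _ _ _ hG hsc
    letI : MeasurableSpace G := borel G
    haveI : BorelSpace G := ⟨rfl⟩
    intro r a ha hat hlb
    obtain ⟨ε, hε, hM, hfam⟩ := h G hG hsc r a ha hat hlb
    exact ⟨1, ε, le_rfl, hε, hM, hfam⟩

end Summit.QuantumFields.YangMills.Cruxes.IR.AfPincerUc.SharpOnset

end
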